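import Mathlib
import Summits.Ventures.PercRepro2.Defs
import Summits.Ventures.PercRepro2.Graph
import Summits.Ventures.PercRepro2.Induced
import Summits.Ventures.PercRepro2.VdBKahn
import Summits.Ventures.PercRepro2.ReimerVdBK
import Summits.Ventures.PercRepro2.ReimerVdBKRegions

/-!
# The private-side signs and the minimal instance of (R-1.2)
(blind cell PercRepro2, mine-c g44; `conjectures/MINE-C.md` §53.0 (b))

For a 2-colouring `ω` let `side v ω = [v ∈ K₁ \ K₂] − [v ∈ K₂ \ K₁] ∈ {−1, 0, 1}` be the PRIVATE SIDE of
the vertex `v` (`+1` if only world 1 reaches it, `−1` if only world 2 does, `0` on the core and outside),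
and let `avoidBoth Z = {Z ∩ (K₁ ∪ K₂) = ∅}` be the symmetric conditioning «neither world reaches `Z`».
The singleton symmetric instance of the conjecture `(R-1.2)`, `RvdBK {a} Z {b} Z`, i.e.
`#{a ∈ K₁, b ∈ K₂, Z ∩ (K₁ ∪ K₂) = ∅} ≤ #{a, b ∈ K₁, Z ∩ (K₁ ∪ K₂) = ∅}`, is EXACTLY the statement
that the private sides of `a` and `b` are positively correlated under the symmetric conditioning:

  `sideCorr a b Z = ∑_ω [ω ∈ avoidBoth Z] · side a ω · side b ω ≥ 0`   (`rvdBK_singleton_iff_sideCorr`),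

in fact `sideCorr a b Z = 2 · (#R − #L)` (`sideCorr_eq`).  Given that neither colour reaches `Z`, two
vertices are more likely on the SAME private side than on opposite sides — the difference of the two
conditional-association statements (CPA_Z), (CNA_Z) of `MINE-C.md` §52 (each false), and `Z = ∅` is
Harris.  The proof is the colour swap: `side v (compl ω) = − side v ω` and `avoidBoth Z` is swap-invariant.
-/

namespace Summit.Ventures.PercRepro2

namespace ReimerVdBK

open Classical

variable {V : Type*} {E : Type*} [Fintype E] [DecidableEq E] [Fintype V] [DecidableEq V]

variable (ends : E → Sym2 V) (s : V)

/-! ## The private side of a vertex -/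

/-- The private side of `v`: `+1` in `K₁ \ K₂`, `−1` in `K₂ \ K₁`, `0` otherwise. -/
noncomputable def side (v : V) (ω : Config E) : ℤ :=
  (if v ∈ only1 ends s ω then 1 else 0) - (if v ∈ only2 ends s ω then 1 else 0)

omit [Fintype E] [DecidableEq E] [Fintype V] [DecidableEq V] in
/-- The private side is the difference of the two membership indicators. -/
lemma side_eq (v : V) (ω : Config E) :
    side ends s v ω = (if v ∈ K₁ ends s ω then 1 else 0) - (if v ∈ K₂ ends s ω then 1 else 0) := by
  unfold side
  by_cases h1 : v ∈ K₁ ends s ω <;> by_cases h2 : v ∈ K₂ ends s ω <;>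
    simp [mem_only1, mem_only2, h1, h2]

omit [Fintype E] [DecidableEq E] [Fintype V] [DecidableEq V] in
/-- The colour swap reverses the private side. -/
lemma side_compl (v : V) (ω : Config E) : side ends s v (compl ω) = - side ends s v ω := by
  rw [side_eq, side_eq, ← K₂_eq_K₁_compl, ← K₁_eq_K₂_compl]
  ring

/-! ## The symmetric conditioning -/

/-- The symmetric conditioning «neither world reaches `Z`». -/
def avoidBoth (Z : Finset V) : Set (Config E) := avoidAll ends s Z ∩ bar (avoidAll ends s Z)

omit [Fintype E] [DecidableEq E] [Fintype V] [DecidableEq V] in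
/-- Membership in the symmetric conditioning. -/
lemma mem_avoidBoth {Z : Finset V} {ω : Config E} :
    ω ∈ avoidBoth ends s Z ↔ (∀ z ∈ Z, z ∉ K₁ ends s ω) ∧ (∀ z ∈ Z, z ∉ K₂ ends s ω) := by
  simp only [avoidBoth, Set.mem_inter_iff, mem_bar, avoidAll, Set.mem_setOf_eq, mem_K₁, mem_K₂]

omit [Fintype E] [DecidableEq E] [Fintype V] [DecidableEq V] in
/-- The symmetric conditioning is invariant under the colour swap. -/
lemma compl_mem_avoidBoth_iff {Z : Finset V} {ω : Config E} :
    compl ω ∈ avoidBoth ends s Z ↔ ω ∈ avoidBoth ends s Z := by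
  rw [mem_avoidBoth, mem_avoidBoth, ← K₂_eq_K₁_compl, ← K₁_eq_K₂_compl]
  exact and_comm

/-! ## The signed correlation and the minimal instance -/

/-- The private-side correlation of `a` and `b` under the symmetric conditioning. -/
noncomputable def sideCorr (a b : V) (Z : Finset V) : ℤ :=
  ∑ ω : Config E, if ω ∈ avoidBoth ends s Z then side ends s a ω * side ends s b ω else 0

omit [Fintype E] [DecidableEq E] [Fintype V] [DecidableEq V] in
/-- The two-world events of the singleton instance, on the conditioning. -/
lemma mem_twoWorld_singleton_left {a b : V} {Z : Finset V} {ω : Config E} :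
    ω ∈ twoWorld ends s {a} Z {b} Z ↔
      ω ∈ avoidBoth ends s Z ∧ a ∈ K₁ ends s ω ∧ b ∈ K₂ ends s ω := by
  rw [mem_twoWorld_iff, mem_avoidBoth]
  simp only [Finset.mem_singleton, forall_eq]
  tauto

omit [Fintype E] [DecidableEq E] [Fintype V] in
/-- The right event of the singleton instance, on the conditioning. -/
lemma mem_twoWorld_singleton_right {a b : V} {Z : Finset V} {ω : Config E} :
    ω ∈ twoWorld ends s ({a} ∪ {b}) (Z ∩ Z) ∅ (Z ∪ Z) ↔
      ω ∈ avoidBoth ends s Z ∧ a ∈ K₁ ends s ω ∧ b ∈ K₁ ends s ω := by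
  rw [mem_twoWorld_iff, mem_avoidBoth, Finset.inter_self, Finset.union_self]
  simp only [Finset.mem_union, Finset.mem_singleton, Finset.notMem_empty, false_imp_iff,
    implies_true, true_and]
  constructor
  · rintro ⟨hQ, hZ, hW⟩
    exact ⟨⟨hZ, hW⟩, hQ a (Or.inl rfl), hQ b (Or.inr rfl)⟩
  · rintro ⟨⟨hZ, hW⟩, ha, hb⟩
    refine ⟨fun v hv => ?_, hZ, hW⟩
    rcases hv with rfl | rfl
    · exact ha
    · exact hb

omit [Fintype E] [DecidableEq E] [Fintype V] [DecidableEq V] in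
/-- The one-configuration identity behind the correlation: on the conditioning,
`side a · side b = ([a ∈ K₁] − [a ∈ K₂]) · ([b ∈ K₁] − [b ∈ K₂])`. -/
lemma side_mul_side (a b : V) (ω : Config E) :
    side ends s a ω * side ends s b ω =
      ((if a ∈ K₁ ends s ω then 1 else 0) - (if a ∈ K₂ ends s ω then 1 else 0)) *
        ((if b ∈ K₁ ends s ω then 1 else 0) - (if b ∈ K₂ ends s ω then 1 else 0)) := by
  rw [side_eq, side_eq]

omit [Fintype V] in
/-- **The correlation is twice the deficit of the singleton instance**:
`sideCorr a b Z = 2 · (Φ({a, b}, Z; ∅, Z) − Φ({a}, Z; {b}, Z))`. -/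
theorem sideCorr_eq (a b : V) (Z : Finset V) :
    sideCorr ends s a b Z =
      2 * ((reimerCount ends s ({a} ∪ {b}) (Z ∩ Z) ∅ (Z ∪ Z) : ℤ) -
        (reimerCount ends s {a} Z {b} Z : ℤ)) := by
  -- the signed sum with world 1's indicator for `a` only
  set g : Config E → ℤ := fun ω =>
    if ω ∈ avoidBoth ends s Z then
      (if a ∈ K₁ ends s ω then 1 else 0) *
        ((if b ∈ K₁ ends s ω then 1 else 0) - (if b ∈ K₂ ends s ω then 1 else 0))
    else 0 with hg
  -- the swap turns the `a ∈ K₂` half into minus the `a ∈ K₁` half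
  have hswap : ∑ ω : Config E, (if ω ∈ avoidBoth ends s Z then
      (if a ∈ K₂ ends s ω then 1 else 0) *
        ((if b ∈ K₁ ends s ω then 1 else 0) - (if b ∈ K₂ ends s ω then 1 else 0)) else 0) =
      - ∑ ω : Config E, g ω := by
    rw [← Finset.sum_neg_distrib]
    refine Fintype.sum_equiv complEquiv _ _ fun ω => ?_
    simp only [hg, complEquiv, Equiv.coe_fn_mk, compl_mem_avoidBoth_iff, ← K₂_eq_K₁_compl,
      ← K₁_eq_K₂_compl]
    split_ifs <;> ring
  -- the correlation is the sum of the two halves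
  have hcorr : sideCorr ends s a b Z = ∑ ω : Config E, g ω - ∑ ω : Config E,
      (if ω ∈ avoidBoth ends s Z then
        (if a ∈ K₂ ends s ω then 1 else 0) *
          ((if b ∈ K₁ ends s ω then 1 else 0) - (if b ∈ K₂ ends s ω then 1 else 0)) else 0) := by
    unfold sideCorr
    rw [← Finset.sum_sub_distrib]
    refine Finset.sum_congr rfl fun ω _ => ?_
    simp only [hg, side_mul_side]
    split_ifs <;> ring
  -- the counts as sums
  have hR : (reimerCount ends s ({a} ∪ {b}) (Z ∩ Z) ∅ (Z ∪ Z) : ℤ) =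
      ∑ ω : Config E, if ω ∈ avoidBoth ends s Z ∧ a ∈ K₁ ends s ω ∧ b ∈ K₁ ends s ω then 1 else 0 := by
    unfold reimerCount count
    push_cast
    refine Finset.sum_congr rfl fun ω _ => ?_
    exact if_congr (mem_twoWorld_singleton_right ends s) rfl rfl
  have hL : (reimerCount ends s {a} Z {b} Z : ℤ) =
      ∑ ω : Config E, if ω ∈ avoidBoth ends s Z ∧ a ∈ K₁ ends s ω ∧ b ∈ K₂ ends s ω then 1 else 0 := by
    unfold reimerCount count
    push_cast
    refine Finset.sum_congr rfl fun ω _ => ?_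
    exact if_congr (mem_twoWorld_singleton_left ends s) rfl rfl
  have hgsum : ∑ ω : Config E, g ω =
      (reimerCount ends s ({a} ∪ {b}) (Z ∩ Z) ∅ (Z ∪ Z) : ℤ) - (reimerCount ends s {a} Z {b} Z : ℤ) := by
    rw [hR, hL, ← Finset.sum_sub_distrib]
    refine Finset.sum_congr rfl fun ω _ => ?_
    simp only [hg]
    split_ifs <;> simp_all
  rw [hcorr, hswap, hgsum]
  ring

omit [Fintype V] in
/-- **The minimal instance of (R-1.2) is the positive correlation of the private sides**:
`RvdBK {a} Z {b} Z ↔ 0 ≤ sideCorr a b Z`. -/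
theorem rvdBK_singleton_iff_sideCorr (a b : V) (Z : Finset V) :
    RvdBK ends s {a} Z {b} Z ↔ 0 ≤ sideCorr ends s a b Z := by
  rw [sideCorr_eq]
  unfold RvdBK
  constructor
  · intro h
    have : (reimerCount ends s {a} Z {b} Z : ℤ) ≤ reimerCount ends s ({a} ∪ {b}) (Z ∩ Z) ∅ (Z ∪ Z) := by
      exact_mod_cast h
    linarith
  · intro h
    have : (reimerCount ends s {a} Z {b} Z : ℤ) ≤ reimerCount ends s ({a} ∪ {b}) (Z ∩ Z) ∅ (Z ∪ Z) := by
      linarith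
    exact_mod_cast this

end ReimerVdBK

end Summit.Ventures.PercRepro2
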